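import Summits.Ventures.Crystal3D.Theorems.StickyWulffConstantPolycrystalWulffBoundPerSelf
import Literature.Analysis.Convexity.BrunnMinkowski

/-!
# `PolycrystalWulffBound`, line `PolyDensity`: the PIECEWISE Brunn–Minkowski chimera lower bound
# («sorted targets»; crux `stmt-Ventures-19482`)

Route `StickyWulffConstant` of the venture `Summits/Ventures/Crystal3D`, second prover lane (poly-p2,
gen 12).  The Brunn–Minkowski route to the polycrystal Wulff bound (`rung_basalLamellar`, gen 3) needs,
for a texture with grains `G_f` and bodies `K_f` (all of volume `κ`, here `κ = 32`), the chimera lower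
bound `(|E'|^{1/3} + r·κ^{1/3})³ ≤ |⋃_f (G_f + r·K_f)|`.  This file isolates the one abstract mechanism
behind every such bound that uses NO wall budget — a discrete Knothe map:

* `piecewise_chimera_lower` — if every grain `G_f` (open, pairwise disjoint, `V = |⋃ G_f| ∈ (0, ∞)`) is
  given a measurable TARGET `T_f` (think `T_f ⊆ K_f`) of volume `≥ κ·|G_f|/V` (PROPORTIONAL targets) and
  the swollen pieces `G_f + r·T_f` are PAIRWISE DISJOINT and contained in `U`, then
  `|⋃ G_f|^{1/3} + r·κ^{1/3} ≤ |U|^{1/3}`.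
  Proof: the tree's Brunn–Minkowski inequality (`Literature.Analysis.Convexity.brunnMinkowski_pow`) piece
  by piece gives `|G_f + r·T_f| ≥ (|G_f|^{1/3} + r(κ|G_f|/V)^{1/3})³ = |G_f|·(1 + r(κ/V)^{1/3})³`, and the
  sum over `f` is EXACTLY `V(1 + r(κ/V)^{1/3})³ = (V^{1/3} + r·κ^{1/3})³`.

All the geometry of a concrete rung goes into manufacturing the targets (quantile slabs / caps of the
bodies along the wall normals) and proving the disjointness of the swollen pieces (sorted height ranges);
see `…TwinCapsChimera.lean` (separated twin caps about different axes).  Separated grains need nothing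
(superadditivity is built in: far-apart pieces are disjoint for small `r` whatever the targets).
* `chimera_lower_of_piece_bounds` (appended) — the same summation with the per-piece volume bounds as
  hypotheses (docking form: a «super-piece» treated by another engine, e.g. a slide chimera confined to a
  sorted height window, contributes its own bound).
WHAT THIS IS NOT: a perimeter statement; no rung by itself; the crux is not claimed.
-/

noncomputable section

open scoped BigOperators InnerProductSpace ENNReal Pointwise
open MeasureTheory Set

namespace Summit.Ventures.Crystal3D.Theorems

/-- **Piecewise Brunn–Minkowski chimera lower bound (sorted proportional targets).**  Let `G_f`
(`f : ι`, finite) be open, pairwise disjoint, with `0 < |⋃ G_f| < ∞`; let `κ > 0`, `r > 0`, and let the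
measurable targets `T_f` have volume `≥ κ·|G_f| / |⋃ G_f|`.  If the swollen pieces `G_f + r·T_f` are
pairwise disjoint subsets of `U`, then `|⋃ G_f|^{1/3} + r·κ^{1/3} ≤ |U|^{1/3}`. -/
theorem piecewise_chimera_lower {ι : Type*} [Fintype ι] (G T : ι → Set (EuclideanSpace ℝ (Fin 3))) {κ : ℝ} (hκ : 0 < κ)
    (hGo : ∀ f, IsOpen (G f)) (hTm : ∀ f, MeasurableSet (T f))
    (hdisjG : Pairwise fun f g => Disjoint (G f) (G g))
    (h0 : volume (⋃ f, G f) ≠ 0) (htop : volume (⋃ f, G f) ≠ ⊤) {r : ℝ} (hr : 0 < r)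
    (hT : ∀ f, ENNReal.ofReal (κ * ((volume (G f)).toReal / (volume (⋃ f, G f)).toReal)) ≤
      volume (T f))
    (hdisj : Pairwise fun f g => Disjoint (G f + r • T f) (G g + r • T g))
    {U : Set (EuclideanSpace ℝ (Fin 3))} (hsub : ∀ f, G f + r • T f ⊆ U) :
    volume (⋃ f, G f) ^ ((3 : ℕ)⁻¹ : ℝ) + ENNReal.ofReal r * (ENNReal.ofReal κ) ^ ((3 : ℕ)⁻¹ : ℝ) ≤
      volume U ^ ((3 : ℕ)⁻¹ : ℝ) := by
  classical
  have hGm : ∀ f, MeasurableSet (G f) := fun f => (hGo f).measurableSet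
  -- volumes
  set V : ℝ≥0∞ := volume (⋃ f, G f) with hV
  have hVsum : V = ∑ f, volume (G f) := by
    rw [hV, measure_iUnion (fun f g hfg => hdisjG hfg) hGm, tsum_fintype]
  have hGfin : ∀ f, volume (G f) ≠ ⊤ := fun f =>
    (lt_of_le_of_lt (measure_mono (subset_iUnion G f)) htop.lt_top).ne
  set Vr : ℝ := V.toReal with hVr
  set v : ι → ℝ := fun f => (volume (G f)).toReal with hv
  have hv0 : ∀ f, 0 ≤ v f := fun f => ENNReal.toReal_nonneg
  have hVr_eq : Vr = ∑ f, v f := by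
    rw [hVr, hVsum, ENNReal.toReal_sum fun f _ => hGfin f]
  have hVr0 : 0 < Vr := ENNReal.toReal_pos h0 htop
  -- the exponent and the common dilation factor
  have hn3 : (3 : ℕ) ≠ 0 := by norm_num
  set θ : ℝ := ((3 : ℕ) : ℝ)⁻¹ with hθ
  have hθ0 : 0 < θ := by rw [hθ]; positivity
  set c : ℝ := (κ / Vr) ^ θ with hc
  have hκV : 0 ≤ κ / Vr := div_nonneg hκ.le hVr0.le
  have hc0 : 0 ≤ c := Real.rpow_nonneg hκV _
  -- Brunn–Minkowski piece by piece
  have piece : ∀ f, ENNReal.ofReal (v f * (1 + r * c) ^ 3) ≤ volume (G f + r • T f) := by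
    intro f
    by_cases hG0 : volume (G f) = 0
    · have : v f = 0 := by simp only [hv, hG0, ENNReal.toReal_zero]
      rw [this, zero_mul, ENNReal.ofReal_zero]
      exact bot_le
    have hvpos : 0 < v f := ENNReal.toReal_pos hG0 (hGfin f)
    have hGne : (G f).Nonempty := nonempty_of_measure_ne_zero hG0
    have hKpos : 0 < κ * (v f / Vr) := by positivity
    have hTvol : ENNReal.ofReal (κ * (v f / Vr)) ≤ volume (T f) := hT f
    have hTne : (r • T f).Nonempty := by
      have hT0 : volume (T f) ≠ 0 := by
        intro h0'
        rw [h0'] at hTvol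
        exact absurd (le_antisymm hTvol bot_le) (ENNReal.ofReal_pos.2 hKpos).ne'
      exact (nonempty_of_measure_ne_zero hT0).smul_set
    set a : ℝ := v f ^ θ with ha
    set b : ℝ := r * (κ * (v f / Vr)) ^ θ with hb
    have ha0 : 0 ≤ a := Real.rpow_nonneg (hv0 f) _
    have hb0 : 0 ≤ b := mul_nonneg hr.le (Real.rpow_nonneg hKpos.le _)
    have ha3 : a ^ 3 = v f := by rw [ha, hθ]; exact Real.rpow_inv_natCast_pow (hv0 f) hn3
    have hb3 : b ^ 3 = r ^ 3 * (κ * (v f / Vr)) := by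
      rw [hb, mul_pow, hθ, Real.rpow_inv_natCast_pow hKpos.le hn3]
    have hvA : ENNReal.ofReal (a ^ 3) ≤ volume (G f) := by
      rw [ha3, hv, ENNReal.ofReal_toReal (hGfin f)]
    have hvB : ENNReal.ofReal (b ^ 3) ≤ volume (r • T f) := by
      rw [hb3, Measure.addHaar_smul, finrank_euclideanSpace, Fintype.card_fin,
        abs_of_pos (pow_pos hr 3), ENNReal.ofReal_mul (pow_nonneg hr.le 3)]
      gcongr
    have hBM := Literature.Analysis.Convexity.brunnMinkowski_pow (n := 3) (hGm f)
      ((hTm f).const_smul₀ r) ((hGo f).add_right).measurableSet hGne hTne ha0 hb0 hvA hvB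
    have hab : (a + b) ^ 3 = v f * (1 + r * c) ^ 3 := by
      have h1 : b = a * (r * c) := by
        rw [hb, ha, hc, show κ * (v f / Vr) = v f * (κ / Vr) by ring, Real.mul_rpow (hv0 f) hκV]
        ring
      rw [h1, show a + a * (r * c) = a * (1 + r * c) by ring, mul_pow, ha3]
    rw [← hab]
    exact hBM
  -- add up over the disjoint pieces
  have hsum : ENNReal.ofReal (Vr * (1 + r * c) ^ 3) ≤ volume U := by
    have h1c : 0 ≤ (1 + r * c) ^ 3 := pow_nonneg (by positivity) 3
    have hpm : ∀ f, MeasurableSet (G f + r • T f) := fun f => ((hGo f).add_right).measurableSet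
    calc ENNReal.ofReal (Vr * (1 + r * c) ^ 3)
        = ENNReal.ofReal (∑ f, v f * (1 + r * c) ^ 3) := by rw [hVr_eq, Finset.sum_mul]
      _ = ∑ f, ENNReal.ofReal (v f * (1 + r * c) ^ 3) :=
          ENNReal.ofReal_sum_of_nonneg fun f _ => mul_nonneg (hv0 f) h1c
      _ ≤ ∑ f, volume (G f + r • T f) := Finset.sum_le_sum fun f _ => piece f
      _ = volume (⋃ f, (G f + r • T f)) := by
          rw [measure_iUnion (fun f g hfg => hdisj hfg) hpm, tsum_fintype]
      _ ≤ volume U := measure_mono (iUnion_subset hsub)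
  -- `Vr·(1 + r c)³ = (Vr^{1/3} + r·κ^{1/3})³`, then cube roots
  set x : ℝ := Vr ^ θ with hx
  set y : ℝ := r * κ ^ θ with hy
  have hx0 : 0 ≤ x := Real.rpow_nonneg hVr0.le _
  have hy0 : 0 ≤ y := mul_nonneg hr.le (Real.rpow_nonneg hκ.le _)
  have hx3 : x ^ 3 = Vr := by rw [hx, hθ]; exact Real.rpow_inv_natCast_pow hVr0.le hn3
  have hxc : x * c = κ ^ θ := by
    rw [hx, hc, ← Real.mul_rpow hVr0.le hκV, mul_div_cancel₀ _ hVr0.ne']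
  have hcube : Vr * (1 + r * c) ^ 3 = (x + y) ^ 3 := by
    rw [← hx3, ← mul_pow]
    congr 1
    rw [hy, ← hxc]; ring
  rw [hcube] at hsum
  have hroot := ENNReal.rpow_le_rpow hsum hθ0.le
  rw [ENNReal.ofReal_rpow_of_nonneg (pow_nonneg (add_nonneg hx0 hy0) _) hθ0.le, hθ,
    Real.pow_rpow_inv_natCast (add_nonneg hx0 hy0) hn3, ENNReal.ofReal_add hx0 hy0] at hroot
  have hX : ENNReal.ofReal x = V ^ θ := by
    rw [hx, ← ENNReal.ofReal_rpow_of_nonneg hVr0.le hθ0.le, hVr, ENNReal.ofReal_toReal htop]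
  have hY : ENNReal.ofReal y = ENNReal.ofReal r * ENNReal.ofReal κ ^ θ := by
    rw [hy, ENNReal.ofReal_mul hr.le, ENNReal.ofReal_rpow_of_nonneg hκ.le hθ0.le]
  rw [hX, hY] at hroot
  exact hroot


/-- **Chimera lower bound from PER-PIECE bounds** (docking form of `piecewise_chimera_lower`): if the
pieces have volumes `v f ≥ 0` with `Σ v f = |E'|`, `0 < |E'| < ∞`, and pairwise disjoint measurable sets
`S f ⊆ U` satisfy `|S f| ≥ (v_f^{1/3} + r·(κ v_f/|E'|)^{1/3})³` (the sorted Brunn–Minkowski bound of a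
piece — or ANY engine's bound for a «super-piece», e.g. a slide chimera confined to a height window),
then `|E'|^{1/3} + r·κ^{1/3} ≤ |U|^{1/3}`.  The algebra is the same exact summation. -/
theorem chimera_lower_of_piece_bounds {ι : Type*} [Fintype ι] (v : ι → ℝ) (hv0 : ∀ f, 0 ≤ v f)
    {V : ℝ≥0∞} (h0 : V ≠ 0) (htop : V ≠ ⊤) (hVsum : V.toReal = ∑ f, v f) {κ r : ℝ} (hκ : 0 < κ)
    (hr : 0 < r) (S : ι → Set (EuclideanSpace ℝ (Fin 3))) (hSm : ∀ f, MeasurableSet (S f))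
    (hdisj : Pairwise fun f g => Disjoint (S f) (S g)) {U : Set (EuclideanSpace ℝ (Fin 3))}
    (hsub : ∀ f, S f ⊆ U)
    (hbound : ∀ f, ENNReal.ofReal ((v f ^ ((3 : ℕ)⁻¹ : ℝ) +
        r * (κ * (v f / V.toReal)) ^ ((3 : ℕ)⁻¹ : ℝ)) ^ 3) ≤ volume (S f)) :
    V ^ ((3 : ℕ)⁻¹ : ℝ) + ENNReal.ofReal r * (ENNReal.ofReal κ) ^ ((3 : ℕ)⁻¹ : ℝ) ≤
      volume U ^ ((3 : ℕ)⁻¹ : ℝ) := by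
  classical
  set Vr : ℝ := V.toReal with hVr
  have hVr0 : 0 < Vr := ENNReal.toReal_pos h0 htop
  have hn3 : (3 : ℕ) ≠ 0 := by norm_num
  set θ : ℝ := ((3 : ℕ) : ℝ)⁻¹ with hθ
  have hθ0 : 0 < θ := by rw [hθ]; positivity
  set c : ℝ := (κ / Vr) ^ θ with hc
  have hκV : 0 ≤ κ / Vr := div_nonneg hκ.le hVr0.le
  have hc0 : 0 ≤ c := Real.rpow_nonneg hκV _
  -- per piece: `(v^{1/3} + r(κ v/V)^{1/3})³ = v (1 + r c)³`
  have hpiece : ∀ f, (v f ^ θ + r * (κ * (v f / Vr)) ^ θ) ^ 3 = v f * (1 + r * c) ^ 3 := by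
    intro f
    have h1 : r * (κ * (v f / Vr)) ^ θ = v f ^ θ * (r * c) := by
      rw [hc, show κ * (v f / Vr) = v f * (κ / Vr) by ring, Real.mul_rpow (hv0 f) hκV]; ring
    rw [h1, show v f ^ θ + v f ^ θ * (r * c) = v f ^ θ * (1 + r * c) by ring, mul_pow, hθ,
      Real.rpow_inv_natCast_pow (hv0 f) hn3]
  have hsum : ENNReal.ofReal (Vr * (1 + r * c) ^ 3) ≤ volume U := by
    have h1c : 0 ≤ (1 + r * c) ^ 3 := pow_nonneg (by positivity) 3
    calc ENNReal.ofReal (Vr * (1 + r * c) ^ 3)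
        = ENNReal.ofReal (∑ f, v f * (1 + r * c) ^ 3) := by rw [hVsum, Finset.sum_mul]
      _ = ∑ f, ENNReal.ofReal (v f * (1 + r * c) ^ 3) :=
          ENNReal.ofReal_sum_of_nonneg fun f _ => mul_nonneg (hv0 f) h1c
      _ ≤ ∑ f, volume (S f) := Finset.sum_le_sum fun f _ => by rw [← hpiece f]; exact hbound f
      _ = volume (⋃ f, S f) := by rw [measure_iUnion (fun f g hfg => hdisj hfg) hSm, tsum_fintype]
      _ ≤ volume U := measure_mono (iUnion_subset hsub)
  set x : ℝ := Vr ^ θ with hx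
  set y : ℝ := r * κ ^ θ with hy
  have hx0 : 0 ≤ x := Real.rpow_nonneg hVr0.le _
  have hy0 : 0 ≤ y := mul_nonneg hr.le (Real.rpow_nonneg hκ.le _)
  have hx3 : x ^ 3 = Vr := by rw [hx, hθ]; exact Real.rpow_inv_natCast_pow hVr0.le hn3
  have hxc : x * c = κ ^ θ := by
    rw [hx, hc, ← Real.mul_rpow hVr0.le hκV, mul_div_cancel₀ _ hVr0.ne']
  have hcube : Vr * (1 + r * c) ^ 3 = (x + y) ^ 3 := by
    rw [← hx3, ← mul_pow]
    congr 1
    rw [hy, ← hxc]; ring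
  rw [hcube] at hsum
  have hroot := ENNReal.rpow_le_rpow hsum hθ0.le
  rw [ENNReal.ofReal_rpow_of_nonneg (pow_nonneg (add_nonneg hx0 hy0) _) hθ0.le, hθ,
    Real.pow_rpow_inv_natCast (add_nonneg hx0 hy0) hn3, ENNReal.ofReal_add hx0 hy0] at hroot
  have hX : ENNReal.ofReal x = V ^ θ := by
    rw [hx, ← ENNReal.ofReal_rpow_of_nonneg hVr0.le hθ0.le, hVr, ENNReal.ofReal_toReal htop]
  have hY : ENNReal.ofReal y = ENNReal.ofReal r * ENNReal.ofReal κ ^ θ := by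
    rw [hy, ENNReal.ofReal_mul hr.le, ENNReal.ofReal_rpow_of_nonneg hκ.le hθ0.le]
  rw [hX, hY] at hroot
  exact hroot

end Summit.Ventures.Crystal3D.Theorems

end
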